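import Summits.Parity.GeneralizedHardyLittlewood.Theorems.GreenTaoLevelTwoGITwoCyclicInverseBohrSize

/-!
# Route `GreenTaoLevelTwo`, crux `GITwo` (stmt-Parity-21275), line `birth`, stub `stub_cyclicInverse`:
# the doubling bound for Bohr sets `#B(S, 2ρ) ≤ 4^d · #B(S, ρ)` (GT08a arXiv Lemma 35, upper bound)

Twenty-first helper file toward the XL stub `stub_cyclicInverse` (B. Green, T. Tao, *An inverse
theorem for the Gowers `U³(G)` norm*, arXiv:math/0503014, Thm. 68 = PEMS 51 (2008) Thm. 12.8).
Block B5 of the printed proof (§8, "Some results on Bohr sets") starts with the two size bounds of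
arXiv Lemma 35; the lower bound is `card_bohr_ge` / `card_bohr_ge_rho` (files `…BohrSize`,
`…BohrSizeRho`).  This def-free file lands the UPPER (doubling) bound, in the covering form of
Tao–Vu, *Additive Combinatorics*, Lemma 4.20 (constant `4^d`; the paper's integration argument gives
`5^d`), with Bohr sets spelled through `ZMod.toAddCircle` exactly as in the sibling files:

* `norm_toAddCircle_eq_abs_liftR` (`‖toAddCircle y‖ = |lift y|`, `lift y = val y/N − round(val y/N)`
  the representative nearest to `0`, kept inline) and `norm_toAddCircle_sub_le_abs_liftR_sub`
  (`‖toAddCircle (y − y')‖ ≤ |lift y − lift y'|`);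
* `abs_sub_lt_of_floor_div_eq` — equal box indices `⌊(u+2r)/r⌋ = ⌊(v+2r)/r⌋` force `|u − v| < r`;
* `card_bohr_two_mul_le` — **arXiv Lemma 35 (upper bound)**: for `r > 0`,
  `#B(S, 2r) ≤ 4^{#S} · #B(S, r)`: the `4^{#S}` boxes `∏_ξ ⌊(lift(xξ) + 2r)/r⌋ ∈ {0,1,2,3}^S` cover
  `B(S,2r)` (`lift` as above), and each box translates injectively into `B(S,r)` by `x ↦ x − x₀`.

Next (file `…BohrRegular`): regular Bohr sets are ubiquitous (arXiv Lemma 36).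

References: [GreenTao2008U3Inverse] arXiv:math/0503014, Lemma 35; T. Tao, V. Vu, *Additive
Combinatorics*, Lemma 4.20.
-/

noncomputable section

namespace Summit.Parity.GeneralizedHardyLittlewood.GreenTaoLevelTwoGITwoCyclicInverse

open Finset

variable {N : ℕ} [NeZero N]

/-- `‖toAddCircle y‖ = |val y/N − round(val y/N)|` (the lift of `val y / N` nearest to `0`; kept
inline, this file being definition-free). [folklore] -/
theorem norm_toAddCircle_eq_abs_liftR (y : ZMod N) :
    ‖ZMod.toAddCircle y‖ = |(y.val : ℝ) / N - round ((y.val : ℝ) / N)| := by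
  rw [ZMod.toAddCircle_apply, UnitAddCircle.norm_eq]

/-- `‖toAddCircle (y − y')‖ ≤ |lift(y) − lift(y')|` for the nearest lifts. [folklore] -/
theorem norm_toAddCircle_sub_le_abs_liftR_sub (y y' : ZMod N) :
    ‖ZMod.toAddCircle (y - y')‖ ≤
      |((y.val : ℝ) / N - round ((y.val : ℝ) / N)) -
        ((y'.val : ℝ) / N - round ((y'.val : ℝ) / N))| := by
  rw [map_sub, ZMod.toAddCircle_apply, ZMod.toAddCircle_apply, ← AddCircle.coe_sub,
    UnitAddCircle.norm_eq]
  have h := round_le ((y.val : ℝ) / N - (y'.val : ℝ) / N)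
    (round ((y.val : ℝ) / N) - round ((y'.val : ℝ) / N))
  refine h.trans (le_of_eq ?_)
  rw [Int.cast_sub]
  ring_nf

/-- Equal box indices `⌊(u + 2r)/r⌋ = ⌊(v + 2r)/r⌋` (`r > 0`) force `|u − v| < r`. [folklore] -/
theorem abs_sub_lt_of_floor_div_eq {u v r : ℝ} (hr : 0 < r)
    (h : ⌊(u + 2 * r) / r⌋ = ⌊(v + 2 * r) / r⌋) : |u - v| < r := by
  have h1 := Int.abs_sub_lt_one_of_floor_eq_floor h
  rw [← sub_div, abs_div, abs_of_pos hr, div_lt_one hr] at h1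
  simpa using h1

/-- The box index of a lift of norm `< 2r` lies in `{0, 1, 2, 3}`. [folklore] -/
theorem floor_div_mem_Icc {u r : ℝ} (hr : 0 < r) (hu : |u| < 2 * r) :
    ⌊(u + 2 * r) / r⌋ ∈ Finset.Icc (0 : ℤ) 3 := by
  rw [abs_lt] at hu
  rw [Finset.mem_Icc]
  constructor
  · refine Int.floor_nonneg.mpr (div_nonneg (by linarith) hr.le)
  · have : (u + 2 * r) / r < 4 := by
      rw [div_lt_iff₀ hr]; linarith
    have h4 : ⌊(u + 2 * r) / r⌋ < (4 : ℤ) := Int.floor_lt.mpr (by exact_mod_cast this)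
    omega

/-- **Bohr sets: the doubling bound (GT08a arXiv Lemma 35, upper bound; Tao–Vu Lemma 4.20).**
For `S ⊆ ℤ/Nℤ` and `r > 0`: `#B(S, 2r) ≤ 4^{#S} · #B(S, r)`, where
`B(S, ρ) = {x : ‖toAddCircle(x ξ)‖ < ρ ∀ ξ ∈ S}`. [cite: GreenTao2008U3Inverse, Lemma 35] -/
theorem card_bohr_two_mul_le (S : Finset (ZMod N)) {r : ℝ} (hr : 0 < r) :
    #{x : ZMod N | ∀ ξ ∈ S, ‖ZMod.toAddCircle (x * ξ)‖ < 2 * r} ≤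
      4 ^ #S * #{x : ZMod N | ∀ ξ ∈ S, ‖ZMod.toAddCircle (x * ξ)‖ < r} := by
  classical
  set B2 : Finset (ZMod N) := {x : ZMod N | ∀ ξ ∈ S, ‖ZMod.toAddCircle (x * ξ)‖ < 2 * r} with hB2
  set B1 : Finset (ZMod N) := {x : ZMod N | ∀ ξ ∈ S, ‖ZMod.toAddCircle (x * ξ)‖ < r} with hB1
  -- the box map
  let box : ZMod N → (↥S → ℤ) := fun x ξ =>
    ⌊((((x * (ξ : ZMod N)).val : ℝ) / N - round ((((x * (ξ : ZMod N)).val : ℝ) / N))) + 2 * r) / r⌋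
  -- each fibre of `box` on `B2` translates injectively into `B1`
  have hfib : ∀ y ∈ B2.image box, #(B2.filter fun x => box x = y) ≤ #B1 := by
    intro y hy
    obtain ⟨x₀, hx₀, hx₀y⟩ := mem_image.mp hy
    refine Finset.card_le_card_of_injOn (fun x => x - x₀) ?_ ?_
    · intro x hx
      rw [mem_coe, mem_filter] at hx
      rw [mem_coe, hB1, mem_filter]
      refine ⟨mem_univ _, fun ξ hξ => ?_⟩
      have hsame : box x ⟨ξ, hξ⟩ = box x₀ ⟨ξ, hξ⟩ := by rw [hx.2, hx₀y]
      have hlt := abs_sub_lt_of_floor_div_eq hr hsame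
      rw [sub_mul]
      exact (norm_toAddCircle_sub_le_abs_liftR_sub _ _).trans_lt hlt
    · intro x _ x' _ h
      exact sub_left_injective h
  have h1 : #B2 ≤ #B1 * #(B2.image box) := Finset.card_le_mul_card_image B2 (#B1) hfib
  -- the image of `box` lies in `{0,1,2,3}^S`
  have himg : B2.image box ⊆ Fintype.piFinset fun _ : ↥S => Finset.Icc (0 : ℤ) 3 := by
    intro y hy
    obtain ⟨x, hx, rfl⟩ := mem_image.mp hy
    rw [hB2, mem_filter] at hx
    rw [Fintype.mem_piFinset]
    intro ξ
    refine floor_div_mem_Icc hr ?_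
    rw [← norm_toAddCircle_eq_abs_liftR]
    exact hx.2 ξ ξ.2
  have h2 : #(B2.image box) ≤ 4 ^ #S := by
    refine (card_le_card himg).trans (le_of_eq ?_)
    rw [Fintype.card_piFinset, prod_const, Finset.card_univ, Fintype.card_coe]
    rfl
  calc #B2 ≤ #B1 * #(B2.image box) := h1
    _ ≤ #B1 * 4 ^ #S := Nat.mul_le_mul_left _ h2
    _ = 4 ^ #S * #B1 := Nat.mul_comm _ _

end Summit.Parity.GeneralizedHardyLittlewood.GreenTaoLevelTwoGITwoCyclicInverse
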